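import Summits.BirchSwinnertonDyer.BirchSwinnertonDyer.Theorems.RamifiedHeegnerPairLeafRankZeroUpperAtThreeTwistUnitNonsplit
import HarnessLib

/-!
# Route `RamifiedHeegnerPair`, residual crux U₀ `LeafRankZeroUpperAtThree` (stmt-BirchSwinnertonDyer-26024), line `splitkolyvagin0` —
# the EXACT extra stub: the PARTNER-LOWER supply PL₁ (U₀ ⟸ PUB₀⁺ ∧ S2 ∧ Σ★″ ∧ PL₁; PL₁ ⟸ L₁, PL₁ ⟸ TU₀, PL₁ ⟸ the leaf; U₀|3Nn ⟸ … ∧ PL₁|3Nn)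

HONEST FRAMING. Theorems only; helper file (`--supports stmt-BirchSwinnertonDyer-26024`); nothing is booked, no item is closed, BSD is not proved for
any curve; CONDITIONAL on every displayed input. Lead prover bsd-line-rhp-p2 g7, 2026-08-28; mirror of `…LeafRankOneUpperAtThreePartnerLower.lean`,
sequel of `…LeafRankZeroUpperAtThreeTwistUnit.lean` (p631701) and `…TwistUnitNonsplit.lean` (p633230).

WHAT the U₀ composition actually consumes of L₁ (26021) is the LOWER half of ONE rank-one Heegner partner of the given rank-zero curve (and of L₀
only `L(W,1)/Ω_W ∈ ℚ`, which is print: modular symbols). This file isolates that input — the PARTNER-LOWER supply on the rank-zero side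
  PL₁(W) := ∃ K imaginary quadratic (odd `d_K`, Heegner for `N_W`) with `L(W^{(d_K)},1) = 0 ≠ L′(W^{(d_K)},1)` and a globally minimal model `Wd` of
            `W^{(d_K)}` with `Typed.MissingLowerBoundAt Wd 3` (spelled inline)
and proves (ns `…Theorems.RamifiedPairUpperBound`): §1 `leafRankZeroUpper_three_of_sigmaAtDatum_of_partnerLowerZero` (datum level; p611715 §2 with
(Bump–Friedberg–Hoffstein, L₁, L₀) ↦ (PL₁(W), modular-symbol rationality)); §2 tam-free rows (print + PL₁(W)); §3 mono-carrier rows (S2 by name + PL₁(W));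
§4 lattice-optimal member (S2 + Σ★″ by name + PL₁(W)); §5 `leafRankZeroUpperAtThree_of_pubManin_of_divisibilityReading_of_sigmaStar_of_partnerLowerZero :
PUB₀⁺ → S2 → Σ★″ → PL₁ → LeafRankZeroUpperAtThree` and the `3Nn`-restricted form `leafRankZeroUpper_nonsplitRows_…_of_partnerLowerZeroNonsplit` (kolyvagin_split
v5's fifth stub text ⟸ PUB₀⁺ ∧ S2 ∧ Σ★″ ∧ PL₁|3Nn). The three SOURCES of PL₁ (⟸ L₁ with the Bump–Friedberg–Hoffstein field; ⟸ TU₀(W); ⟸ the LEAF —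
tightness, no surplus) are the sequel file `…LeafRankZeroUpperAtThreePartnerLowerSources.lean`.

NET (mod print): U₀ ⟸ S2 ∧ Σ★″ ∧ PL₁; U₀|3Nn ⟸ S2 ∧ Σ★″ ∧ PL₁|3Nn; PL₁ ⟸ L₁ | TU₀ | leaf. For NT 27201: PL₁|3Nn from L₁ is the circle, from TU₀|3Nn it is
not — PL₁|3Nn is the exact residual either way. BSD is not proved; U₀ / L₁ / TU₀ / PL₁ are OPEN. References:
[cite: BumpFriedbergHoffstein1990, Theorem (Introduction, pp. 543–544)] [cite: CastellaGrossiLeeSkinner2022, proof of Thm. 5.3.1, display (5.6)]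
[cite: MilneADT2006, Thm. I.7.3 and Remark I.7.4] [cite: MatarNekovar2019, Thm. 0.7 (p. 456) and §0.11 (p. 457)] [cite: Jetchev2008, Conj. 1.3, Thm. 1.4 (p. 812)]
[cite: Serre1972, §2.4 Prop. 15] [cite: Mazur1978, Cor. 4.1] [cite: Miller2011LMS, §1 and Def. 1.1].
-/

-- D-0017: single-problem summit, so `Summit.BirchSwinnertonDyer.BirchSwinnertonDyer.…` repeats a namespace BY DESIGN.
set_option linter.dupNamespace false
set_option autoImplicit false

noncomputable section

open scoped Classical NumberField

open WeierstrassCurve IsDedekindDomain IsDedekindDomain.HeightOneSpectrum NumberField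
  Rat.HeightOneSpectrum Literature Literature.NumberTheory.EllipticCurves
  Literature.NumberTheory.EllipticCurves.ModularForms
  Literature.NumberTheory.EllipticCurves.Rank1Residual
  Literature.NumberTheory.EllipticCurves.Rank1Residual.Typed
  Literature.NumberTheory.EllipticCurves.KrizLi2019
  Literature.NumberTheory.QuadraticFields
  Summit.BirchSwinnertonDyer.Rank1Residual
  Summit.BirchSwinnertonDyer.Rank1Residual.Additive
  Summit.BirchSwinnertonDyer.Rank1Residual.X11b.Three
  Summit.BirchSwinnertonDyer.BirchSwinnertonDyer.Theses.RamifiedHeegnerPair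
  Summit.BirchSwinnertonDyer.BirchSwinnertonDyer.Theorems
  Summit.BirchSwinnertonDyer.BirchSwinnertonDyer.Theorems.SchneiderFree

namespace Summit.BirchSwinnertonDyer.BirchSwinnertonDyer.Theorems.RamifiedPairUpperBound

/-! ## §1 One datum: U₀ at `W` from Σ₀ at the datum over the PARTNER-LOWER field -/

/-- **U₀ AT `W` from Σ₀ AT ONE PARAMETRISATION DATUM over the partner-lower field — L₁-FREE and L₀-FREE.** For a non-CM leaf curve `W` of analytic rank
`0`, a parametrisation datum `Dt` at level `N_E`, and PL₁(W) (`hPL`): IF Σ₀ holds at `Dt` (`hSig`), THEN `Typed.MissingUpperBoundAt W 3` — given the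
printed facts `hGZ hKo hGZK hmod hMN` and parametrisation data `hmodP` (for `L(W,1)/Ω_W ∈ ℚ`). p611715 §2 with PL₁'s field and model: the twist model is
irreducible at `3` (`X11b.hasIrreducibleModPGaloisRep_twist_model`), of analytic rank one (simple zero), its lower half is GIVEN; receptacle
`upper_of_globalDivisibility_of_irreducible`, bookkeeping `jointUpperBoundAt_three_of_indexUpper_rankZero`, lever `missingUpperBoundAt_of_jointUpper_of_lower`.
CONDITIONAL; nothing asserted. [cite: CastellaGrossiLeeSkinner2022, proof of Thm. 5.3.1, display (5.6)] [cite: MatarNekovar2019, Thm. 0.7 (p. 456)]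
[cite: Jetchev2008, Conj. 1.3] [cite: Miller2011LMS, Def. 1.1] -/
theorem leafRankZeroUpper_three_of_sigmaAtDatum_of_partnerLowerZero
    (hGZ : ∀ (N : ℕ) [NeZero N] (W : WeierstrassCurve ℚ) (K : Type) [Field K] [NumberField K],
      gross_zagier N W K)
    (hKo : ∀ (N : ℕ) [NeZero N] (W : WeierstrassCurve ℚ) (K : Type) [Field K] [NumberField K],
      kolyvagin N W K)
    (hGZK : rank_eq_analyticRank_of_analyticRank_le_one) (hmod : hasEntireLFunction_rat)
    (hMN : MatarNekovar2019.thm07_padicValNat_card_sha_primary_add_le_of_globalDivisibility_of_irreducible)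
    (hmodP : nonempty_modularParametrizationData)
    (W : WeierstrassCurve ℚ) [W.IsElliptic] [W.IsGloballyMinimal] [NeZero (W.conductorNorm ℤ)]
    (hCM : ¬ W.HasCM) (hadd : Addv W 3) (hsub : SubGss W 3) (hr : W.analyticRank = 0)
    (Dt : ModularParametrizationData W (W.conductorNorm ℤ))
    (hPL : ∃ (K : Type) (_ : Field K) (_ : NumberField K) (Wd : WeierstrassCurve ℚ) (_ : Wd.IsElliptic) (_ : Wd.IsGloballyMinimal),
      IsImaginaryQuadratic K ∧ Odd (NumberField.discr K) ∧ SatisfiesHeegnerHypothesis (W.conductorNorm ℤ) K ∧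
      (W.quadraticTwist (NumberField.discr K : ℚ)).entireLFunction 1 = 0 ∧
      deriv (W.quadraticTwist (NumberField.discr K : ℚ)).entireLFunction 1 ≠ 0 ∧
      (∃ C : VariableChange ℚ, C • W.quadraticTwist (NumberField.discr K : ℚ) = Wd) ∧ MissingLowerBoundAt Wd 3)
    (hSig : ∀ (K : Type) [Field K] [NumberField K]
      (H : HeegnerDatum (W.conductorNorm ℤ) (NumberField.discr K)) (ι : K →+* ℂ) (P : (W.baseChange K).toAffine.Point),
      IsImaginaryQuadratic K → SatisfiesHeegnerHypothesis (W.conductorNorm ℤ) K →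
      (W.quadraticTwist (NumberField.discr K : ℚ)).entireLFunction 1 = 0 →
      deriv (W.quadraticTwist (NumberField.discr K : ℚ)).entireLFunction 1 ≠ 0 →
      WeierstrassCurve.Affine.Point.map ι.toRatAlgHom P = heegnerPointComplex Dt H → ¬ IsOfFinAddOrder P →
      Odd (NumberField.discr K) →
      ∀ (s' : ℕ), s' ≤ padicValNat 3 W.tamagawaProduct + padicValNat 3 Dt.c.natAbs →
      ∀ (n : ℕ) (d : KolyvaginHeegnerData Dt H.β ι n), Squarefree n →
      (∀ ℓ ∈ n.primeFactors, Zhang2014.IsKolyvaginPrime (W.conductorNorm ℤ) W K 3 ℓ ∧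
        s' ≤ Zhang2014.kolyvaginIndex W 3 ℓ) → Koly.PDiv d 3 s') :
    MissingUpperBoundAt W 3 := by
  have hirr : W.HasIrreducibleModPGaloisRep 3 := (classX4_three_of_addv_of_subGss W hadd hsub).2.2
  have h3N : 3 ∣ W.conductorNorm ℤ :=
    (W.dvd_conductorNorm_iff_not_hasGoodReductionAtPrime 3).mpr (not_good_of_addv W 3 hadd)
  obtain ⟨K, _, _, Wd, _, _, hK, hodd, hHN, hL0, hLd1, ⟨C, hC⟩, hlow⟩ := hPL
  have h3 : NumberField.discr K ≠ -3 := by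
    intro h
    exact (X11b.Three.not_dvd_discr_and_not_dvd_torsionOrder_of_heegner hK hHN (by decide) h3N).1
      (h ▸ ⟨-1, by norm_num⟩)
  have h4 : NumberField.discr K ≠ -4 := by
    intro h
    rw [h] at hodd
    exact (Int.not_odd_iff_even.mpr ⟨-2, by norm_num⟩) hodd
  -- the Heegner datum and the `K`-rational Heegner point of `Dt`
  obtain ⟨β, hβ⟩ := exists_dvd_sq_sub_discr_holds (W.conductorNorm ℤ) K hK hHN
  obtain ⟨H, -⟩ := nonempty_heegnerDatum_holds (W.conductorNorm ℤ) K hK hβ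
  obtain ⟨ι⟩ : Nonempty (K →+* ℂ) := inferInstance
  obtain ⟨P, hP⟩ := heegnerPointComplex_mem_range_map_holds (W.conductorNorm ℤ) W K hK hHN Dt H ι
  -- the twist model: analytic rank one (simple zero), irreducible at `3`
  have hD0 : (NumberField.discr K : ℚ) ≠ 0 := by exact_mod_cast NumberField.discr_ne_zero K
  haveI hEt : (W.quadraticTwist (NumberField.discr K : ℚ)).IsElliptic := W.isElliptic_quadraticTwist hD0
  have hrt : (W.quadraticTwist (NumberField.discr K : ℚ)).analyticRank = 1 := by
    have hg : AnalyticAt ℂ (W.quadraticTwist (NumberField.discr K : ℚ)).entireLFunction 1 :=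
      ((W.quadraticTwist (NumberField.discr K : ℚ)).differentiable_entireLFunction (hmod _)).analyticAt 1
    have h1 := hg.analyticOrderAt_eq_one_of_zero_deriv_ne_zero hL0 hLd1
    simp only [WeierstrassCurve.analyticRank, analyticOrderNatAt, h1]
    rfl
  have hrd : Wd.analyticRank = 1 := by
    rw [← hC, analyticRank_smul]
    exact hrt
  have hirrd : Wd.HasIrreducibleModPGaloisRep 3 := X11b.hasIrreducibleModPGaloisRep_twist_model W 3 K hK.1 hirr C hC
  -- the Heegner point is non-torsion (`L(E,1)·L′(E^{(d_K)},1) ≠ 0`)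
  have hLW : W.entireLFunction 1 ≠ 0 := (W.analyticRank_eq_zero_iff_holds (hmod W)).1 hr
  have hLK : LDerivEK W K ≠ 0 := by
    rw [AdditivePotMult.lDerivEK_eq_mul_deriv W K hmod hL0]
    exact mul_ne_zero hLW hLd1
  have hnt : ¬ IsOfFinAddOrder P :=
    (lDerivEK_ne_zero_iff_not_isOfFinAddOrder W (W.conductorNorm ℤ) K (hGZ _ W K) hK hHN ⟨Dt, H, ι, hP⟩).mp hLK
  -- Σ₀ at this datum ⟹ the socket (orientation-free receptacle, p607279)
  have hI : Upper.IndexUpperBoundLeAt W 3 K P (padicValNat 3 Dt.c.natAbs) :=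
    upper_of_globalDivisibility_of_irreducible hKo hMN W 3 (by decide) hCM hirr K hK h3 h4 hHN Dt H ι P hP hnt
      (fun s' hs' n d hn hℓ ↦ hSig K H ι P hK hHN hL0 hLd1 hP hnt hodd s' hs' n d hn hℓ)
  -- the joint upper half (rationality of `L(W,1)/Ω_W` by modular symbols; of `#Ш_an` of the twist from its lower half)
  obtain ⟨qd, hqd, -⟩ := id hlow
  have hJ : Upper.JointUpperBoundAt W Wd 3 :=
    jointUpperBoundAt_three_of_indexUpper_rankZero W K Dt H ι P Wd C (hGZ _ W K) (hKo _ W K) hGZK hmod hK hHN hodd hP hC h3N hirr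
      hirrd hr hrd (X1.RankZeroPartner.exists_rat_entireLFunction_one_div_realPeriodRat hmodP W) ⟨qd, hqd⟩ hI
  exact Upper.missingUpperBoundAt_of_jointUpper_of_lower hJ hlow

/-! ## §2 The Tamagawa-free rank-zero rows: U₀ ⟸ printed facts + PL₁(W) -/

/-- **U₀ on the TAMAGAWA-FREE rank-zero rows from PRINT + PL₁(W) ALONE** (`3 ∤ ∏_ℓ c_ℓ(W)`, a datum at level `N_E` with `3 ∤ c`): the depth of Σ₀ is
`0`. Weaker hypotheses than p611715 (L₁, L₀) and p631701 §2 (TU₀). [cite: MatarNekovar2019, Thm. 0.7 (p. 456) and §0.11 (p. 457)]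
[cite: CastellaGrossiLeeSkinner2022, proof of Thm. 5.3.1, display (5.6)] [cite: Miller2011LMS, Def. 1.1] -/
theorem leafRankZeroUpper_three_tamFree_of_print_of_partnerLowerZero
    (hGZ : ∀ (N : ℕ) [NeZero N] (W : WeierstrassCurve ℚ) (K : Type) [Field K] [NumberField K],
      gross_zagier N W K)
    (hKo : ∀ (N : ℕ) [NeZero N] (W : WeierstrassCurve ℚ) (K : Type) [Field K] [NumberField K],
      kolyvagin N W K)
    (hGZK : rank_eq_analyticRank_of_analyticRank_le_one) (hmod : hasEntireLFunction_rat)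
    (hMN : MatarNekovar2019.thm07_padicValNat_card_sha_primary_add_le_of_globalDivisibility_of_irreducible)
    (hmodP : nonempty_modularParametrizationData)
    (W : WeierstrassCurve ℚ) [W.IsElliptic] [W.IsGloballyMinimal] [NeZero (W.conductorNorm ℤ)]
    (hCM : ¬ W.HasCM) (hadd : Addv W 3) (hsub : SubGss W 3) (hr : W.analyticRank = 0)
    (htam : ¬ 3 ∣ W.tamagawaProduct)
    (Dt : ModularParametrizationData W (W.conductorNorm ℤ)) (hc : ¬ (3 : ℤ) ∣ Dt.c)
    (hPL : ∃ (K : Type) (_ : Field K) (_ : NumberField K) (Wd : WeierstrassCurve ℚ) (_ : Wd.IsElliptic) (_ : Wd.IsGloballyMinimal),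
      IsImaginaryQuadratic K ∧ Odd (NumberField.discr K) ∧ SatisfiesHeegnerHypothesis (W.conductorNorm ℤ) K ∧
      (W.quadraticTwist (NumberField.discr K : ℚ)).entireLFunction 1 = 0 ∧
      deriv (W.quadraticTwist (NumberField.discr K : ℚ)).entireLFunction 1 ≠ 0 ∧
      (∃ C : VariableChange ℚ, C • W.quadraticTwist (NumberField.discr K : ℚ) = Wd) ∧ MissingLowerBoundAt Wd 3) :
    MissingUpperBoundAt W 3 := by
  have ht0 : padicValNat 3 W.tamagawaProduct = 0 := padicValNat.eq_zero_of_not_dvd htam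
  have hc0 : padicValNat 3 Dt.c.natAbs = 0 :=
    padicValNat.eq_zero_of_not_dvd fun h ↦ hc (Int.ofNat_dvd_left.mpr h)
  refine leafRankZeroUpper_three_of_sigmaAtDatum_of_partnerLowerZero hGZ hKo hGZK hmod hMN hmodP W hCM hadd hsub hr Dt hPL ?_
  intro K _ _ H ι P _ _ _ _ _ _ _ s' hs' n d _ _
  have hs0 : s' = 0 := by omega
  subst hs0
  exact koly_pDiv_zero d 3

/-! ## §3 The mono-multiplicative-carrier rank-zero rows: U₀ ⟸ print + S2 + PL₁(W) -/

/-- **U₀ AT A RANK-ZERO LEAF CURVE ON A MONO-MULTIPLICATIVE-CARRIER ROW WITH A MANIN-CLEAN DATUM, from S2 (item 27492 BY NAME) and PL₁(W).** §1 with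
Σ₀ at `Dt` from p616826 §1. CONDITIONAL; nothing asserted. [cite: Jetchev2008, Thm. 1.4 and Cor. 1.5 (p. 812)] [cite: MatarNekovar2019, Thm. 0.7 (p. 456)]
[cite: CastellaGrossiLeeSkinner2022, proof of Thm. 5.3.1, display (5.6)] [cite: Miller2011LMS, Def. 1.1] -/
theorem leafRankZeroUpper_three_monoCarrier_of_divisibilityReading_of_partnerLowerZero
    (hGZ : ∀ (N : ℕ) [NeZero N] (W : WeierstrassCurve ℚ) (K : Type) [Field K] [NumberField K],
      gross_zagier N W K)
    (hKo : ∀ (N : ℕ) [NeZero N] (W : WeierstrassCurve ℚ) (K : Type) [Field K] [NumberField K],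
      kolyvagin N W K)
    (hGZK : rank_eq_analyticRank_of_analyticRank_le_one) (hmod : hasEntireLFunction_rat)
    (hMN : MatarNekovar2019.thm07_padicValNat_card_sha_primary_add_le_of_globalDivisibility_of_irreducible)
    (hmodP : nonempty_modularParametrizationData) (hD : JetchevDivisibilityReadingS2)
    (W : WeierstrassCurve ℚ) [W.IsElliptic] [W.IsGloballyMinimal] [NeZero (W.conductorNorm ℤ)]
    (hCM : ¬ W.HasCM) (hadd : Addv W 3) (hsub : SubGss W 3) (hr : W.analyticRank = 0)
    (q : ℕ) [Fact q.Prime] (hqN : q ∣ W.conductorNorm ℤ) (hq2 : ¬ q ^ 2 ∣ W.conductorNorm ℤ)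
    (hmono : padicValNat 3 W.tamagawaProduct ≤ padicValNat 3 ((W.baseChange ℚ_[q]).localTamagawaNumber ℤ_[q]))
    (htam : ∀ (q' : ℕ) [Fact q'.Prime], q' ∣ W.conductorNorm ℤ →
      3 ∣ (W.baseChange ℚ_[q']).localTamagawaNumber ℤ_[q'] → ¬ q' ^ 2 ∣ W.conductorNorm ℤ)
    (Dt : ModularParametrizationData W (W.conductorNorm ℤ)) (hc : ¬ (3 : ℤ) ∣ Dt.c)
    (hPL : ∃ (K : Type) (_ : Field K) (_ : NumberField K) (Wd : WeierstrassCurve ℚ) (_ : Wd.IsElliptic) (_ : Wd.IsGloballyMinimal),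
      IsImaginaryQuadratic K ∧ Odd (NumberField.discr K) ∧ SatisfiesHeegnerHypothesis (W.conductorNorm ℤ) K ∧
      (W.quadraticTwist (NumberField.discr K : ℚ)).entireLFunction 1 = 0 ∧
      deriv (W.quadraticTwist (NumberField.discr K : ℚ)).entireLFunction 1 ≠ 0 ∧
      (∃ C : VariableChange ℚ, C • W.quadraticTwist (NumberField.discr K : ℚ) = Wd) ∧ MissingLowerBoundAt Wd 3) :
    MissingUpperBoundAt W 3 :=
  leafRankZeroUpper_three_of_sigmaAtDatum_of_partnerLowerZero hGZ hKo hGZK hmod hMN hmodP W hCM hadd hsub hr Dt hPL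
    (fun K _ _ H ι P hK hHN _ _ hP hnt hodd s' hs' n d hn hℓ ↦
      sigmaAtDatum_three_of_divisibilityReading_monoCarrier hD W hCM hadd hsub q hqN hq2 hmono htam Dt hc K H ι P hK hHN hP
        hnt hodd s' hs' n d hn hℓ)

/-! ## §4 At a lattice-optimal member: U₀ ⟸ print⁺ + S2 + Σ★″ + PL₁(W) -/

/-- **U₀ AT A RANK-ZERO LEAF CURVE CARRYING A LATTICE-OPTIMAL DATUM ⟸ print⁺ + S2 (27492) + Σ★″ (27493) + PL₁(W).** Case split on the row predicate
as p621612 §4₀ / p631701 §4. CONDITIONAL; nothing asserted. [cite: Jetchev2008, Conj. 1.3, Thm. 1.4 (p. 812)] [cite: MatarNekovar2019, Thm. 0.7 (p. 456)]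
[cite: Mazur1978, Cor. 4.1] [cite: Miller2011LMS, Def. 1.1] -/
theorem leafRankZeroUpper_three_of_latticeOptimal_of_divisibilityReading_of_sigmaStar_of_partnerLowerZero
    (hGZ : ∀ (N : ℕ) [NeZero N] (W : WeierstrassCurve ℚ) (K : Type) [Field K] [NumberField K],
      gross_zagier N W K)
    (hKo : ∀ (N : ℕ) [NeZero N] (W : WeierstrassCurve ℚ) (K : Type) [Field K] [NumberField K],
      kolyvagin N W K)
    (hGZK : rank_eq_analyticRank_of_analyticRank_le_one) (hmod : hasEntireLFunction_rat)
    (hMN : MatarNekovar2019.thm07_padicValNat_card_sha_primary_add_le_of_globalDivisibility_of_irreducible)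
    (hnf : exists_isNewformOf) (hmodP : nonempty_modularParametrizationData)
    (hM : mazur_not_dvd_maninConstant_of_odd) (hAU : abbesUllmo_not_dvd_maninConstant_of_not_dvd_level)
    (hC2 : cesnavicius_not_two_dvd_maninConstant_of_two_dvd_level)
    (hD : JetchevDivisibilityReadingS2) (hStar : LeafSigmaStarDivisibilityAtThreeOptimalOffRows)
    (W : WeierstrassCurve ℚ) [W.IsElliptic] [W.IsGloballyMinimal] [NeZero (W.conductorNorm ℤ)]
    (hCM : ¬ W.HasCM) (hadd : Addv W 3) (hsub : SubGss W 3) (hr : W.analyticRank = 0)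
    (Dt : ModularParametrizationData W (W.conductorNorm ℤ))
    (hopt : ∀ z ∈ Dt.L.lattice, ∃ w ∈ periodLattice Dt.f, z = Dt.c * w)
    (hPL : ∃ (K : Type) (_ : Field K) (_ : NumberField K) (Wd : WeierstrassCurve ℚ) (_ : Wd.IsElliptic) (_ : Wd.IsGloballyMinimal),
      IsImaginaryQuadratic K ∧ Odd (NumberField.discr K) ∧ SatisfiesHeegnerHypothesis (W.conductorNorm ℤ) K ∧
      (W.quadraticTwist (NumberField.discr K : ℚ)).entireLFunction 1 = 0 ∧
      deriv (W.quadraticTwist (NumberField.discr K : ℚ)).entireLFunction 1 ≠ 0 ∧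
      (∃ C : VariableChange ℚ, C • W.quadraticTwist (NumberField.discr K : ℚ) = Wd) ∧ MissingLowerBoundAt Wd 3) :
    MissingUpperBoundAt W 3 := by
  by_cases hrow : ((∃ (q : ℕ) (_ : Fact q.Prime), q ∣ W.conductorNorm ℤ ∧ ¬ q ^ 2 ∣ W.conductorNorm ℤ ∧
          padicValNat 3 W.tamagawaProduct ≤ padicValNat 3 ((W.baseChange ℚ_[q]).localTamagawaNumber ℤ_[q])) ∧
        (∀ (q' : ℕ) [Fact q'.Prime], q' ∣ W.conductorNorm ℤ →
          3 ∣ (W.baseChange ℚ_[q']).localTamagawaNumber ℤ_[q'] → ¬ q' ^ 2 ∣ W.conductorNorm ℤ))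
  · obtain ⟨⟨q, _, hqN, hq2, hmono⟩, htam⟩ := hrow
    exact leafRankZeroUpper_three_monoCarrier_of_divisibilityReading_of_partnerLowerZero hGZ hKo hGZK hmod hMN hmodP hD W hCM hadd hsub
      hr q hqN hq2 hmono htam Dt (not_three_dvd_c_of_latticeOptimal_of_subGss hM hAU hC2 hnf W Dt hopt hadd hsub) hPL
  · exact leafRankZeroUpper_three_of_sigmaAtDatum_of_partnerLowerZero hGZ hKo hGZK hmod hMN hmodP W hCM hadd hsub hr Dt hPL
      (fun K _ _ H ι P hK hHN hL0' hLd1 hP hnt hodd s' hs' n d hn hℓ ↦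
        sigmaZeroOptOffRows_of_sigmaStarOptOffRows hStar W (W.conductorNorm ℤ) K Dt H ι P hCM hadd hsub hr rfl hopt hrow hK
          hHN hL0' hLd1 hP hnt hodd s' hs' n d hn hℓ)

/-! ## §5 The class statements BY NAME: U₀ ⟸ PUB₀⁺ ∧ S2 ∧ Σ★″ ∧ PL₁ and U₀|3Nn ⟸ PUB₀⁺ ∧ S2 ∧ Σ★″ ∧ PL₁|3Nn -/

/-- **`LeafRankZeroUpperAtThree` (item 26024) BY NAME ⟸ PUB₀⁺ ∧ S2 (27492) ∧ Σ★″ (27493) ∧ PL₁** (PL₁ := every non-CM leaf curve of analytic rank `0`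
has a rank-one Heegner partner carrying its lower half; inline). NEITHER L₁ NOR L₀ is a hypothesis. Optimal member, §4, Cassels back. CONDITIONAL; U₀ stays
OPEN; BSD is not proved. [cite: Jetchev2008, Conj. 1.3, Thm. 1.4 (p. 812)] [cite: MatarNekovar2019, Thm. 0.7 and Thm. 0.3 (p. 456)] [cite: Mazur1978, Cor. 4.1]
[cite: MilneADT2006, Thm. I.7.3] [cite: Miller2011LMS, Def. 1.1] -/
theorem leafRankZeroUpperAtThree_of_pubManin_of_divisibilityReading_of_sigmaStar_of_partnerLowerZero
    (hpub : (∀ (N : ℕ) [NeZero N] (W : WeierstrassCurve ℚ) (K : Type) [Field K] [NumberField K],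
        Literature.NumberTheory.EllipticCurves.gross_zagier N W K) ∧
      (∀ (N : ℕ) [NeZero N] (W : WeierstrassCurve ℚ) (K : Type) [Field K] [NumberField K],
        Literature.NumberTheory.EllipticCurves.kolyvagin N W K) ∧
      Literature.NumberTheory.EllipticCurves.rank_eq_analyticRank_of_analyticRank_le_one ∧
      WeierstrassCurve.hasEntireLFunction_rat ∧
      Literature.NumberTheory.EllipticCurves.MatarNekovar2019.thm07_padicValNat_card_sha_primary_add_le_of_globalDivisibility_of_irreducible ∧
      Literature.NumberTheory.EllipticCurves.ModularForms.exists_isNewformOf ∧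
      Literature.NumberTheory.EllipticCurves.bumpFriedbergHoffstein_exists_heegnerField_split_twist_simpleZero ∧
      Literature.NumberTheory.EllipticCurves.ModularForms.nonempty_modularParametrizationData ∧
      WeierstrassCurve.bsdRHS_eq_of_isIsogenous ∧
      Literature.NumberTheory.EllipticCurves.ModularForms.mazur_not_dvd_maninConstant_of_odd ∧
      Literature.NumberTheory.EllipticCurves.ModularForms.abbesUllmo_not_dvd_maninConstant_of_not_dvd_level ∧
      Literature.NumberTheory.EllipticCurves.ModularForms.cesnavicius_not_two_dvd_maninConstant_of_two_dvd_level)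
    (hD : JetchevDivisibilityReadingS2) (hStar : LeafSigmaStarDivisibilityAtThreeOptimalOffRows)
    (hPL : ∀ (W : WeierstrassCurve ℚ) [W.IsElliptic] [W.IsGloballyMinimal], ¬ W.HasCM →
      Literature.NumberTheory.EllipticCurves.Rank1Residual.Addv W 3 →
      Summit.BirchSwinnertonDyer.Rank1Residual.Additive.SubGss W 3 → W.analyticRank = 0 →
      ∃ (K : Type) (_ : Field K) (_ : NumberField K) (Wd : WeierstrassCurve ℚ) (_ : Wd.IsElliptic) (_ : Wd.IsGloballyMinimal),
        IsImaginaryQuadratic K ∧ Odd (NumberField.discr K) ∧ SatisfiesHeegnerHypothesis (W.conductorNorm ℤ) K ∧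
        (W.quadraticTwist (NumberField.discr K : ℚ)).entireLFunction 1 = 0 ∧
        deriv (W.quadraticTwist (NumberField.discr K : ℚ)).entireLFunction 1 ≠ 0 ∧
        (∃ C : VariableChange ℚ, C • W.quadraticTwist (NumberField.discr K : ℚ) = Wd) ∧ MissingLowerBoundAt Wd 3) :
    LeafRankZeroUpperAtThree := by
  intro W _ _ hCM hadd hsub hr
  obtain ⟨hGZ, hKo, hGZK, hmod, hMN, hnf, -, hmodP, hCassels, hM, hAU, hC2⟩ := hpub
  obtain ⟨W₀, hW₀, hW₀', N, hN0, D₀, hiso, hN₀, -, hopt, hCM₀, hadd₀, hsub₀, hr₀⟩ :=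
    exists_optimal_leaf_member hnf W hCM hadd hsub
  haveI := hW₀
  haveI := hW₀'
  haveI := hN0
  have hr₀' : W₀.analyticRank = 0 := hr₀.trans hr
  have h₀ : MissingUpperBoundAt W₀ 3 := by
    subst hN₀
    exact leafRankZeroUpper_three_of_latticeOptimal_of_divisibilityReading_of_sigmaStar_of_partnerLowerZero hGZ hKo hGZK hmod hMN
      hnf hmodP hM hAU hC2 hD hStar W₀ hCM₀ hadd₀ hsub₀ hr₀' D₀ hopt (hPL W₀ hCM₀ hadd₀ hsub₀ hr₀')
  exact missingUpperBoundAt_of_isIsogenous_of_analyticRank_le_one hCassels hGZK hmod (by rw [hr]; exact zero_le_one) hiso h₀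

/-- **U₀ on the `3Nn` rank-zero rows (kolyvagin_split v5's fifth stub text VERBATIM) ⟸ PUB₀⁺ ∧ S2 ∧ Σ★″ ∧ PL₁|3Nn** — the EXACT input of NT's road
(p625317 §10); PL₁|3Nn ⟸ L₁ at the twist (the circle) or ⟸ TU₀|3Nn (circle-free, p633230 / the Sources sequel). The optimal member stays `3Nn` (Γ_ℚ-iso `E[3] ≃ E₀[3]`).
CONDITIONAL; nothing asserted. [cite: Serre1972, §2.4 Prop. 15] [cite: MatarNekovar2019, Thm. 0.7 (p. 456)] [cite: Jetchev2008, Conj. 1.3, Thm. 1.4 (p. 812)]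
[cite: Miller2011LMS, Def. 1.1] -/
theorem leafRankZeroUpper_nonsplitRows_of_pubManin_of_divisibilityReading_of_sigmaStar_of_partnerLowerZeroNonsplit
    (hpub : (∀ (N : ℕ) [NeZero N] (W : WeierstrassCurve ℚ) (K : Type) [Field K] [NumberField K],
        Literature.NumberTheory.EllipticCurves.gross_zagier N W K) ∧
      (∀ (N : ℕ) [NeZero N] (W : WeierstrassCurve ℚ) (K : Type) [Field K] [NumberField K],
        Literature.NumberTheory.EllipticCurves.kolyvagin N W K) ∧
      Literature.NumberTheory.EllipticCurves.rank_eq_analyticRank_of_analyticRank_le_one ∧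
      WeierstrassCurve.hasEntireLFunction_rat ∧
      Literature.NumberTheory.EllipticCurves.MatarNekovar2019.thm07_padicValNat_card_sha_primary_add_le_of_globalDivisibility_of_irreducible ∧
      Literature.NumberTheory.EllipticCurves.ModularForms.exists_isNewformOf ∧
      Literature.NumberTheory.EllipticCurves.bumpFriedbergHoffstein_exists_heegnerField_split_twist_simpleZero ∧
      Literature.NumberTheory.EllipticCurves.ModularForms.nonempty_modularParametrizationData ∧
      WeierstrassCurve.bsdRHS_eq_of_isIsogenous ∧
      Literature.NumberTheory.EllipticCurves.ModularForms.mazur_not_dvd_maninConstant_of_odd ∧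
      Literature.NumberTheory.EllipticCurves.ModularForms.abbesUllmo_not_dvd_maninConstant_of_not_dvd_level ∧
      Literature.NumberTheory.EllipticCurves.ModularForms.cesnavicius_not_two_dvd_maninConstant_of_two_dvd_level)
    (hD : JetchevDivisibilityReadingS2) (hStar : LeafSigmaStarDivisibilityAtThreeOptimalOffRows)
    (hPL : ∀ (W : WeierstrassCurve ℚ) [W.IsElliptic] [W.IsGloballyMinimal], ¬ W.HasCM →
      Literature.NumberTheory.EllipticCurves.Rank1Residual.Addv W 3 →
      Summit.BirchSwinnertonDyer.Rank1Residual.Additive.SubGss W 3 → W.analyticRank = 0 →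
      ¬ W.HasSurjectiveModNGaloisRep 3 →
      ∃ (K : Type) (_ : Field K) (_ : NumberField K) (Wd : WeierstrassCurve ℚ) (_ : Wd.IsElliptic) (_ : Wd.IsGloballyMinimal),
        IsImaginaryQuadratic K ∧ Odd (NumberField.discr K) ∧ SatisfiesHeegnerHypothesis (W.conductorNorm ℤ) K ∧
        (W.quadraticTwist (NumberField.discr K : ℚ)).entireLFunction 1 = 0 ∧
        deriv (W.quadraticTwist (NumberField.discr K : ℚ)).entireLFunction 1 ≠ 0 ∧
        (∃ C : VariableChange ℚ, C • W.quadraticTwist (NumberField.discr K : ℚ) = Wd) ∧ MissingLowerBoundAt Wd 3) :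
    ∀ (W : WeierstrassCurve ℚ) [W.IsElliptic] [W.IsGloballyMinimal], ¬ W.HasCM →
      Literature.NumberTheory.EllipticCurves.Rank1Residual.Addv W 3 →
      Summit.BirchSwinnertonDyer.Rank1Residual.Additive.SubGss W 3 → W.analyticRank = 0 →
      ¬ W.HasSurjectiveModNGaloisRep 3 →
      Literature.NumberTheory.EllipticCurves.Rank1Residual.Typed.MissingUpperBoundAt W 3 := by
  intro W _ _ hCM hadd hsub hr hns
  obtain ⟨hGZ, hKo, hGZK, hmod, hMN, hnf, -, hmodP, hCassels, hM, hAU, hC2⟩ := hpub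
  obtain ⟨W₀, hW₀, hW₀', N, hN0, D₀, hiso, hN₀, -, hopt, hCM₀, hadd₀, hsub₀, hr₀⟩ :=
    exists_optimal_leaf_member hnf W hCM hadd hsub
  haveI := hW₀
  haveI := hW₀'
  haveI := hN0
  have hr₀' : W₀.analyticRank = 0 := hr₀.trans hr
  have hirr : W.HasIrreducibleModPGaloisRep 3 := (classX4_three_of_addv_of_subGss W hadd hsub).2.2
  obtain ⟨e, he⟩ :=
    Summit.BirchSwinnertonDyer.BirchSwinnertonDyer.Rank1Residual.exists_torsionIso_of_isIsogenous_of_irreducible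
      (p := 3) hirr hiso
  have hns₀ : ¬ W₀.HasSurjectiveModNGaloisRep 3 := fun h ↦
    hns ((GaloisImage.hasSurjectiveModNGaloisRep_iff_of_torsionIso e he).mpr h)
  have h₀ : MissingUpperBoundAt W₀ 3 := by
    subst hN₀
    exact leafRankZeroUpper_three_of_latticeOptimal_of_divisibilityReading_of_sigmaStar_of_partnerLowerZero hGZ hKo hGZK hmod hMN
      hnf hmodP hM hAU hC2 hD hStar W₀ hCM₀ hadd₀ hsub₀ hr₀' D₀ hopt (hPL W₀ hCM₀ hadd₀ hsub₀ hr₀' hns₀)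
  exact missingUpperBoundAt_of_isIsogenous_of_analyticRank_le_one hCassels hGZK hmod (by rw [hr]; exact zero_le_one) hiso h₀

end Summit.BirchSwinnertonDyer.BirchSwinnertonDyer.Theorems.RamifiedPairUpperBound

end
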